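import Summits.RiemannHypothesis.RiemannHypothesis.Theorems.WeilCombCombShapePositivityBumpCellBounds
import Literature.NumberTheory.LFunctions.WeilArchimedeanMoments
import Mathlib.MeasureTheory.Integral.Bochner.Set

/-!
# Certified constants of the fixed bump: `∫ φ₀ ≤ 0.4475`, `‖φ₀‖₂² ≥ 0.1309`, hence `I₀² ≤ 1.53 · N₀`
(crux `WeilComb.CombShapePositivity`, item stmt-RiemannHypothesis-11229, line `Sketch`, towards `stub_windowCore`)

`φ₀(u) = expNegInvGlue (1 − u²)`, `I₀ = ∫ φ₀ = 0.44399…`, `N₀ = ‖φ₀‖₂² = ∫ φ₀² = 0.13309…`, `I₀²/N₀ = 1.4812…`.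
The band budget of Theorem B (skeleton `stub_assemble40`, `assemble_inv25`) used only Cauchy–Schwarz `I₀² ≤ 2N₀`; the
ratio enters the diagonal (`log(2I₀²/N₀)`), the pole and the off-diagonal constants. Here an interval certificate gives
`I₀² ≤ (153/100) N₀` (`integral_shapeBump_sq_le`): `∫ φ₀ = 2∫₀¹ φ₀` is bounded above by 15 tangent/chord cells of width
`3/50` on `[0, 9/10]` (`cell_integral_shapeBump_le`) plus the monotone tail `φ₀(9/10)/10`, and `∫ φ₀² ≥ 2∫₀^{4/5} φ₀²` is
bounded below by 8 geometric-mean cells of width `1/10` (`le_cell_integral_shapeBump_sq`); the 24 exponentials at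
rational points are certified by `exp_le_pow_eight` / `pow_eight_le_exp` (rational arithmetic, `norm_num`).
-/

noncomputable section

-- the sub-problem path `RiemannHypothesis/RiemannHypothesis` (single-conjunct summit, D-0017) duplicates a namespace
set_option linter.dupNamespace false

open Real MeasureTheory Set intervalIntegral

namespace Summit.RiemannHypothesis.RiemannHypothesis.Theorems.WeilCombBohrFejer

open Literature.NumberTheory.LFunctions

/-! ## The upper bound `∫₀^{9/10} φ₀ ≤ C_I` by 15 cells of width `3/50` -/

/-- The `k`-th cell majorant `exp(g(c_k) + (δ_k h/2)²/2)`, `c_k = 3k/50 + 3/100`, `h = 3/50`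
(the right-hand side of `cell_integral_shapeBump_le`). [folklore] -/
def bumpICell (k : ℕ) : ℝ :=
  Real.exp (-(1 - ((3 / 50 : ℝ) * k + 3 / 50 / 2) ^ 2)⁻¹ +
    (2 * ((3 / 50 : ℝ) * k + 3 / 50 / 2) / (1 - ((3 / 50 : ℝ) * k + 3 / 50 / 2) ^ 2) ^ 2 * (3 / 50) / 2) ^ 2 / 2)

/-- Rational upper bounds for the 15 cell majorants (`exp_le_pow_eight`). [folklore] -/
theorem sum_bumpICell_le : ∑ k ∈ Finset.range 15, (3 / 50 : ℝ) * bumpICell k ≤ ((111611127 / 500000000) : ℝ) := by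
  have h0 : bumpICell 0 ≤ ((459483 / 1250000) : ℝ) := by
    unfold bumpICell
    exact exp_le_pow_eight (x := (-(1251 / 10000) : ℝ)) (w := ((882409 / 1000000) : ℝ)) (by norm_num) (by norm_num) (by norm_num) (by norm_num)
  have h1 : bumpICell 1 ≤ ((3649487 / 10000000) : ℝ) := by
    unfold bumpICell
    exact exp_le_pow_eight (x := (-(63 / 500) : ℝ)) (w := ((176323 / 200000) : ℝ)) (by norm_num) (by norm_num) (by norm_num) (by norm_num)
  have h2 : bumpICell 2 ≤ ((3597327 / 10000000) : ℝ) := by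
    unfold bumpICell
    exact exp_le_pow_eight (x := (-(639 / 5000) : ℝ)) (w := ((88003 / 100000) : ℝ)) (by norm_num) (by norm_num) (by norm_num) (by norm_num)
  have h3 : bumpICell 3 ≤ ((351481 / 1000000) : ℝ) := by
    unfold bumpICell
    exact exp_le_pow_eight (x := (-(1307 / 10000) : ℝ)) (w := ((877481 / 1000000) : ℝ)) (by norm_num) (by norm_num) (by norm_num) (by norm_num)
  have h4 : bumpICell 4 ≤ ((850351 / 2500000) : ℝ) := by
    unfold bumpICell
    exact exp_le_pow_eight (x := (-(337 / 2500) : ℝ)) (w := ((873891 / 1000000) : ℝ)) (by norm_num) (by norm_num) (by norm_num) (by norm_num)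
  have h5 : bumpICell 5 ≤ ((3257601 / 10000000) : ℝ) := by
    unfold bumpICell
    exact exp_le_pow_eight (x := (-(701 / 5000) : ℝ)) (w := ((173837 / 200000) : ℝ)) (by norm_num) (by norm_num) (by norm_num) (by norm_num)
  have h6 : bumpICell 6 ≤ ((384717 / 1250000) : ℝ) := by
    unfold bumpICell
    exact exp_le_pow_eight (x := (-(1473 / 10000) : ℝ)) (w := ((215759 / 250000) : ℝ)) (by norm_num) (by norm_num) (by norm_num) (by norm_num)
  have h7 : bumpICell 7 ≤ ((357133 / 1250000) : ℝ) := by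
    unfold bumpICell
    exact exp_le_pow_eight (x := (-(783 / 5000) : ℝ)) (w := ((855047 / 1000000) : ℝ)) (by norm_num) (by norm_num) (by norm_num) (by norm_num)
  have h8 : bumpICell 8 ≤ ((1296729 / 5000000) : ℝ) := by
    unfold bumpICell
    exact exp_le_pow_eight (x := (-(1687 / 10000) : ℝ)) (w := ((844763 / 1000000) : ℝ)) (by norm_num) (by norm_num) (by norm_num) (by norm_num)
  have h9 : bumpICell 9 ≤ ((2280033 / 10000000) : ℝ) := by
    unfold bumpICell
    exact exp_le_pow_eight (x := (-(231 / 1250) : ℝ)) (w := ((831271 / 1000000) : ℝ)) (by norm_num) (by norm_num) (by norm_num) (by norm_num)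
  have h10 : bumpICell 10 ≤ ((479169 / 2500000) : ℝ) := by
    unfold bumpICell
    exact exp_le_pow_eight (x := (-(413 / 2000) : ℝ)) (w := ((813427 / 1000000) : ℝ)) (by norm_num) (by norm_num) (by norm_num) (by norm_num)
  have h11 : bumpICell 11 ≤ ((150049 / 1000000) : ℝ) := by
    unfold bumpICell
    exact exp_le_pow_eight (x := (-(2371 / 10000) : ℝ)) (w := ((788913 / 1000000) : ℝ)) (by norm_num) (by norm_num) (by norm_num) (by norm_num)
  have h12 : bumpICell 12 ≤ ((523007 / 5000000) : ℝ) := by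
    unfold bumpICell
    exact exp_le_pow_eight (x := (-(1411 / 5000) : ℝ)) (w := ((754123 / 1000000) : ℝ)) (by norm_num) (by norm_num) (by norm_num) (by norm_num)
  have h13 : bumpICell 13 ≤ ((297083 / 5000000) : ℝ) := by
    unfold bumpICell
    exact exp_le_pow_eight (x := (-(3529 / 10000) : ℝ)) (w := ((702649 / 1000000) : ℝ)) (by norm_num) (by norm_num) (by norm_num) (by norm_num)
  have h14 : bumpICell 14 ≤ ((241579 / 10000000) : ℝ) := by
    unfold bumpICell
    exact exp_le_pow_eight (x := (-(2327 / 5000) : ℝ)) (w := ((39243 / 62500) : ℝ)) (by norm_num) (by norm_num) (by norm_num) (by norm_num)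
  simp only [Finset.sum_range_succ, Finset.sum_range_zero]
  linarith

/-- `∫₀^{9/10} φ₀ ≤ C_I`. [folklore] -/
theorem integral_shapeBump_main_le :
    ∫ u in (0 : ℝ)..(9 / 10), expNegInvGlue (1 - u ^ 2) ≤ ((111611127 / 500000000) : ℝ) := by
  have hsum := intervalIntegral.sum_integral_adjacent_intervals (μ := volume)
    (f := fun u : ℝ => expNegInvGlue (1 - u ^ 2)) (a := fun k : ℕ => (3 / 50 : ℝ) * k) (n := 15)
    (fun k _ => continuous_shapeBump.intervalIntegrable _ _)
  have e0 : (3 / 50 : ℝ) * ((0 : ℕ) : ℝ) = 0 := by norm_num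
  have e15 : (3 / 50 : ℝ) * ((15 : ℕ) : ℝ) = 9 / 10 := by norm_num
  rw [e0, e15] at hsum
  rw [← hsum]
  have hcell : ∀ k ∈ Finset.range 15,
      ∫ u in ((3 / 50 : ℝ) * k)..((3 / 50 : ℝ) * ((k + 1 : ℕ) : ℝ)),
        expNegInvGlue (1 - u ^ 2) ≤ (3 / 50 : ℝ) * bumpICell k := by
    intro k hk
    have hk14 : (k : ℝ) ≤ 14 := by exact_mod_cast Nat.lt_succ_iff.mp (Finset.mem_range.mp hk)
    have h := cell_integral_shapeBump_le (a := (3 / 50 : ℝ) * k) (h := 3 / 50) (by positivity) (by norm_num)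
      (by linarith)
    have e : (3 / 50 : ℝ) * ((k + 1 : ℕ) : ℝ) = (3 / 50 : ℝ) * k + 3 / 50 := by push_cast; ring
    rw [e]
    exact h
  exact (Finset.sum_le_sum hcell).trans sum_bumpICell_le

/-- The tail `∫_{9/10}^1 φ₀ ≤ φ₀(9/10)/10 ≤ ((51853 / 10000000) : ℝ)/10` (monotonicity). [folklore] -/
theorem integral_shapeBump_tail_le :
    ∫ u in (9 / 10 : ℝ)..1, expNegInvGlue (1 - u ^ 2) ≤ (1 / 10 : ℝ) * ((51853 / 10000000) : ℝ) := by
  have hpt : ∀ u ∈ Icc (9 / 10 : ℝ) 1, expNegInvGlue (1 - u ^ 2) ≤ expNegInvGlue (1 - (9 / 10 : ℝ) ^ 2) :=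
    fun u hu => shapeBump_antitone (by norm_num) hu.1
  have hint := intervalIntegral.integral_mono_on (by norm_num)
    (continuous_shapeBump.intervalIntegrable (μ := volume) (9 / 10 : ℝ) 1)
    (continuous_const.intervalIntegrable (μ := volume) (9 / 10 : ℝ) 1) hpt
  rw [intervalIntegral.integral_const, smul_eq_mul] at hint
  have hval : expNegInvGlue (1 - (9 / 10 : ℝ) ^ 2) ≤ ((51853 / 10000000) : ℝ) := by
    rw [expNegInvGlue_one_sub_sq (by norm_num)]
    exact exp_le_pow_eight (x := (-(3289 / 5000) : ℝ)) (w := ((518019 / 1000000) : ℝ)) (by norm_num) (by norm_num) (by norm_num) (by norm_num)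
  calc ∫ u in (9 / 10 : ℝ)..1, expNegInvGlue (1 - u ^ 2) ≤ (1 - 9 / 10) * expNegInvGlue (1 - (9 / 10 : ℝ) ^ 2) := hint
    _ ≤ (1 / 10 : ℝ) * ((51853 / 10000000) : ℝ) := by
        have := mul_le_mul_of_nonneg_left hval (by norm_num : (0 : ℝ) ≤ 1 / 10)
        linarith

/-! ## The lower bound `∫₀^{4/5} φ₀² ≥ C_N` by 8 cells of width `1/10` -/

/-- The `k`-th cell minorant `exp(g(a_k) + g(a_k + 1/10))`, `a_k = k/10`
(the left-hand side of `le_cell_integral_shapeBump_sq`). [folklore] -/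
def bumpNCell (k : ℕ) : ℝ :=
  Real.exp (-(1 - ((1 / 10 : ℝ) * k) ^ 2)⁻¹ + -(1 - ((1 / 10 : ℝ) * k + 1 / 10) ^ 2)⁻¹)

/-- Rational lower bounds for the 8 cell minorants (`pow_eight_le_exp`). [folklore] -/
theorem le_sum_bumpNCell : ((6548507 / 100000000) : ℝ) ≤ ∑ k ∈ Finset.range 8, (1 / 10 : ℝ) * bumpNCell k := by
  have h0 : ((1339337 / 10000000) : ℝ) ≤ bumpNCell 0 := by
    unfold bumpNCell
    exact pow_eight_le_exp (x := (-(2513 / 10000) : ℝ)) (w := ((194447 / 250000) : ℝ)) (by norm_num) (by norm_num) (by norm_num) (by norm_num) (by norm_num)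
  have h1 : ((1284763 / 10000000) : ℝ) ≤ bumpNCell 1 := by
    unfold bumpNCell
    exact pow_eight_le_exp (x := (-(513 / 2000) : ℝ)) (w := ((386877 / 500000) : ℝ)) (by norm_num) (by norm_num) (by norm_num) (by norm_num) (by norm_num)
  have h2 : ((235117 / 2000000) : ℝ) ≤ bumpNCell 2 := by
    unfold bumpNCell
    exact pow_eight_le_exp (x := (-(669 / 2500) : ℝ)) (w := ((191303 / 250000) : ℝ)) (by norm_num) (by norm_num) (by norm_num) (by norm_num) (by norm_num)
  have h3 : ((253261 / 2500000) : ℝ) ≤ bumpNCell 3 := by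
    unfold bumpNCell
    exact pow_eight_le_exp (x := (-(1431 / 5000) : ℝ)) (w := ((75111 / 100000) : ℝ)) (by norm_num) (by norm_num) (by norm_num) (by norm_num) (by norm_num)
  have h4 : ((801357 / 10000000) : ℝ) ≤ bumpNCell 4 := by
    unfold bumpNCell
    exact pow_eight_le_exp (x := (-(631 / 2000) : ℝ)) (w := ((729421 / 1000000) : ℝ)) (by norm_num) (by norm_num) (by norm_num) (by norm_num) (by norm_num)
  have h5 : ((55239 / 1000000) : ℝ) ≤ bumpNCell 5 := by
    unfold bumpNCell
    exact pow_eight_le_exp (x := (-(181 / 500) : ℝ)) (w := ((27851 / 40000) : ℝ)) (by norm_num) (by norm_num) (by norm_num) (by norm_num) (by norm_num)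
  have h6 : ((147367 / 5000000) : ℝ) ≤ bumpNCell 6 := by
    unfold bumpNCell
    exact pow_eight_le_exp (x := (-(881 / 2000) : ℝ)) (w := ((643693 / 1000000) : ℝ)) (by norm_num) (by norm_num) (by norm_num) (by norm_num) (by norm_num)
  have h7 : ((87297 / 10000000) : ℝ) ≤ bumpNCell 7 := by
    unfold bumpNCell
    exact pow_eight_le_exp (x := (-(1481 / 2500) : ℝ)) (w := ((552873 / 1000000) : ℝ)) (by norm_num) (by norm_num) (by norm_num) (by norm_num) (by norm_num)
  simp only [Finset.sum_range_succ, Finset.sum_range_zero]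
  linarith

/-- `C_N ≤ ∫₀^{4/5} φ₀²`. [folklore] -/
theorem le_integral_shapeBump_sq_main :
    ((6548507 / 100000000) : ℝ) ≤ ∫ u in (0 : ℝ)..(4 / 5), expNegInvGlue (1 - u ^ 2) ^ 2 := by
  have hsq_cont : Continuous fun u : ℝ => expNegInvGlue (1 - u ^ 2) ^ 2 := continuous_shapeBump.pow 2
  have hsum := intervalIntegral.sum_integral_adjacent_intervals (μ := volume)
    (f := fun u : ℝ => expNegInvGlue (1 - u ^ 2) ^ 2) (a := fun k : ℕ => (1 / 10 : ℝ) * k) (n := 8)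
    (fun k _ => hsq_cont.intervalIntegrable _ _)
  have e0 : (1 / 10 : ℝ) * ((0 : ℕ) : ℝ) = 0 := by norm_num
  have e8 : (1 / 10 : ℝ) * ((8 : ℕ) : ℝ) = 4 / 5 := by norm_num
  rw [e0, e8] at hsum
  rw [← hsum]
  have hcell : ∀ k ∈ Finset.range 8, (1 / 10 : ℝ) * bumpNCell k ≤
      ∫ u in ((1 / 10 : ℝ) * k)..((1 / 10 : ℝ) * ((k + 1 : ℕ) : ℝ)),
        expNegInvGlue (1 - u ^ 2) ^ 2 := by
    intro k hk
    have hk7 : (k : ℝ) ≤ 7 := by exact_mod_cast Nat.lt_succ_iff.mp (Finset.mem_range.mp hk)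
    have h := le_cell_integral_shapeBump_sq (a := (1 / 10 : ℝ) * k) (h := 1 / 10) (by positivity) (by norm_num)
      (by linarith)
    have e : (1 / 10 : ℝ) * ((k + 1 : ℕ) : ℝ) = (1 / 10 : ℝ) * k + 1 / 10 := by push_cast; ring
    rw [e]
    exact h
  exact le_sum_bumpNCell.trans (Finset.sum_le_sum hcell)

/-! ## From `[0, 1]` to the line, and the constants -/

/-- The bump vanishes off `(-1, 1]`. [folklore] -/
private theorem shapeBump_eq_zero_of_not_mem {u : ℝ} (hu : u ∉ Ioc (-1 : ℝ) 1) : expNegInvGlue (1 - u ^ 2) = 0 := by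
  apply expNegInvGlue.zero_of_nonpos
  simp only [mem_Ioc, not_and_or, not_lt, not_le] at hu
  rcases hu with h | h <;> nlinarith

/-- The bump is even. [folklore] -/
private theorem shapeBump_neg (u : ℝ) : expNegInvGlue (1 - (-u) ^ 2) = expNegInvGlue (1 - u ^ 2) := by
  rw [neg_sq]

/-- `∫ φ₀ = 2 ∫₀¹ φ₀`. [folklore] -/
private theorem integral_shapeBump_eq_two_mul_k12 :
    ∫ u, expNegInvGlue (1 - u ^ 2) = 2 * ∫ u in (0 : ℝ)..1, expNegInvGlue (1 - u ^ 2) := by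
  rw [← setIntegral_eq_integral_of_forall_compl_eq_zero (s := Ioc (-1 : ℝ) 1)
      (fun u hu => shapeBump_eq_zero_of_not_mem hu),
    ← intervalIntegral.integral_of_le (by norm_num : (-1 : ℝ) ≤ 1),
    ← intervalIntegral.integral_add_adjacent_intervals (b := 0)
      (continuous_shapeBump.intervalIntegrable _ _) (continuous_shapeBump.intervalIntegrable _ _)]
  have hneg : ∫ u in (-1 : ℝ)..0, expNegInvGlue (1 - u ^ 2) = ∫ u in (0 : ℝ)..1, expNegInvGlue (1 - u ^ 2) := by
    have h := intervalIntegral.integral_comp_neg (a := (0 : ℝ)) (b := 1) (f := fun u : ℝ => expNegInvGlue (1 - u ^ 2))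
    simp only [neg_zero, shapeBump_neg] at h
    rw [← h]
  rw [hneg]
  ring

/-- `∫ φ₀² ≥ 2 ∫₀^{4/5} φ₀²`. [folklore] -/
theorem two_mul_le_integral_shapeBump_sq :
    2 * ∫ u in (0 : ℝ)..(4 / 5), expNegInvGlue (1 - u ^ 2) ^ 2 ≤ ∫ u, expNegInvGlue (1 - u ^ 2) ^ 2 := by
  have hsq_cont : Continuous fun u : ℝ => expNegInvGlue (1 - u ^ 2) ^ 2 := continuous_shapeBump.pow 2
  have hsupp : Function.support (fun u : ℝ => expNegInvGlue (1 - u ^ 2) ^ 2) ⊆ Icc (-1) 1 := by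
    intro u hu
    by_contra h
    apply hu
    have h0 : expNegInvGlue (1 - u ^ 2) = 0 := by
      apply shapeBump_eq_zero_of_not_mem
      intro h'
      exact h (Ioc_subset_Icc_self h')
    simp [h0]
  have hint : Integrable fun u : ℝ => expNegInvGlue (1 - u ^ 2) ^ 2 :=
    hsq_cont.integrable_of_hasCompactSupport (HasCompactSupport.of_support_subset_isCompact isCompact_Icc hsupp)
  have h1 : ∫ u in Ioc (-(4 / 5) : ℝ) (4 / 5), expNegInvGlue (1 - u ^ 2) ^ 2 ≤ ∫ u, expNegInvGlue (1 - u ^ 2) ^ 2 :=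
    setIntegral_le_integral hint (Filter.Eventually.of_forall fun u => by positivity)
  rw [← intervalIntegral.integral_of_le (by norm_num : (-(4 / 5) : ℝ) ≤ 4 / 5),
    ← intervalIntegral.integral_add_adjacent_intervals (b := 0)
      (hsq_cont.intervalIntegrable _ _) (hsq_cont.intervalIntegrable _ _)] at h1
  have hneg : ∫ u in (-(4 / 5) : ℝ)..0, expNegInvGlue (1 - u ^ 2) ^ 2 =
      ∫ u in (0 : ℝ)..(4 / 5), expNegInvGlue (1 - u ^ 2) ^ 2 := by
    have h := intervalIntegral.integral_comp_neg (a := (0 : ℝ)) (b := 4 / 5)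
      (f := fun u : ℝ => expNegInvGlue (1 - u ^ 2) ^ 2)
    simp only [neg_zero, shapeBump_neg] at h
    rw [← h]
  rw [hneg] at h1
  linarith

/-- **`I₀ = ∫ φ₀ ≤ 0.4475`** (true value `0.44399…`). [folklore] -/
theorem integral_shapeBump_le : ∫ u, expNegInvGlue (1 - u ^ 2) ≤ 0.4475 := by
  rw [integral_shapeBump_eq_two_mul_k12, ← intervalIntegral.integral_add_adjacent_intervals (b := 9 / 10)
    (continuous_shapeBump.intervalIntegrable _ _) (continuous_shapeBump.intervalIntegrable _ _)]
  have h1 := integral_shapeBump_main_le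
  have h2 := integral_shapeBump_tail_le
  norm_num at h1 h2 ⊢
  linarith

/-- **`N₀ = ‖φ₀‖₂² ≥ 0.1309`** (true value `0.13309…`). [folklore] -/
theorem le_weilNorm2Sq_shapeBump :
    (0.1309 : ℝ) ≤ weilNorm2Sq (fun u : ℝ => ((expNegInvGlue (1 - u ^ 2) : ℝ) : ℂ)) := by
  unfold weilNorm2Sq
  have e : (fun u : ℝ => ‖((expNegInvGlue (1 - u ^ 2) : ℝ) : ℂ)‖ ^ 2) = fun u => expNegInvGlue (1 - u ^ 2) ^ 2 := by
    funext u
    rw [Complex.norm_real, Real.norm_eq_abs, sq_abs]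
  rw [e]
  have h1 := le_integral_shapeBump_sq_main
  have h2 := two_mul_le_integral_shapeBump_sq
  norm_num at h1 ⊢
  linarith

/-- **`I₀² ≤ (153/100) · N₀`** for the fixed bump (true ratio `1.4812…`; Cauchy–Schwarz gives only `2`). [folklore] -/
theorem integral_shapeBump_sq_le :
    (∫ u : ℝ, expNegInvGlue (1 - u ^ 2)) ^ 2 ≤
      153 / 100 * weilNorm2Sq (fun u : ℝ => ((expNegInvGlue (1 - u ^ 2) : ℝ) : ℂ)) := by
  have hI := integral_shapeBump_le
  have hN := le_weilNorm2Sq_shapeBump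
  have hI0 : 0 ≤ ∫ u : ℝ, expNegInvGlue (1 - u ^ 2) := integral_nonneg fun u => expNegInvGlue.nonneg _
  have hsq : (∫ u : ℝ, expNegInvGlue (1 - u ^ 2)) ^ 2 ≤ (0.4475 : ℝ) ^ 2 := pow_le_pow_left₀ hI0 hI 2
  norm_num at hsq hN ⊢
  linarith

end Summit.RiemannHypothesis.RiemannHypothesis.Theorems.WeilCombBohrFejer

end
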